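import Literature.ComputerArithmetic.Russinoff2022.SRTDivision

/-!
# Russinoff, *Formal Verification of Floating-Point Hardware Design* (2nd ed., 2022), Chapter 10
# "SRT Division and Square Root", §10.4 "SRT Square Root" (displays (10.15)–(10.25),
# Lemmas 10.9–10.14)

David M. Russinoff, *Formal Verification of Floating-Point Hardware Design — A Mathematical
Approach*, 2nd ed., Springer (2022), doi:10.1007/978-3-030-87181-9 [cite: Russinoff2022], Part III
"Implementation of Elementary Operations", Chapter 10, §10.4 (the held copy's text chunks
p0177 l.29 – p0181 l.33 of `book:russinoff2022-formal-verification-floating-point-hardware-design`;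
no running heads survive in these chunks, so no printed page numbers are asserted). It rests on the
§10.1 file `SRTDivision` only for the redundancy factor `SRT.rho a r = a/(r−1)` (display (10.5)).
Typed from the engines group's idle Lean lane (HONEST FRAMING: shared numerical engines serving
client cells; rigour lives in the verifiers; every published number belongs to a client cell's
ledger, not to the engines group) as Literature CONTEXT; it formalises the printed statements and
makes NO claim about any hardware design, RTL, the ACL2/RAC tool flow, the Arm square-root units
the chapter mentions, or any engine's code.

## The text being formalised («…» = verbatim prose of the held copy; formulas transliterated)

§10.4: «Let r be a fixed power of 2. Given a positive rational number x in the range» `1/4 ≤ x < 1`,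
«our objective is to construct a sequence of root digits» `q_j ∈ ℤ` «and a corresponding sequence
of partial roots» `Q_j = 1 + Σ_{i=1}^{j} r^(−i) q_i` (10.15), «which converge to» `√x ∈ [1/2, 1)`.
«Note that for all» `j ∈ ℕ`, `r^j Q_j ∈ ℤ`. The digits range over `{−a, …, a}` with
`ρ = a/(r−1)` satisfying (10.5). Partial remainders `R_j = r^j (x − Q_j²)` (10.16).
* **Lemma 10.9** `R_0 = x − 1`, and for `j ≥ 0`,
  `R_{j+1} = r R_j − q_{j+1}(2 Q_j + r^(−(j+1)) q_{j+1})`.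
* Bounds `B̲(j) = −2ρ Q_j + ρ² r^(−j)`, `B̄(j) = 2ρ Q_j + ρ² r^(−j)`; the invariant
  `B̲(j) ≤ R_j ≤ B̄(j)` (10.17).
* **Lemma 10.10** For `j ≥ 0`, `(Q_j − ρ r^(−j))² ≤ x ≤ (Q_j + ρ r^(−j))² ⇔ B̲(j) ≤ R_j ≤ B̄(j)`.
* **Lemma 10.11** `B̲(0) ≤ R_0 ≤ B̄(0)`.
* Selection intervals `U_k(j) = 2(k+ρ)Q_j + (k+ρ)² r^(−(j+1))` (10.18),
  `L_k(j) = 2(k−ρ)Q_j + (k−ρ)² r^(−(j+1))` (10.19).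
* **Lemma 10.12** Let `j ≥ 0` and `−a ≤ k ≤ a`. If `L_k(j) ≤ r R_j ≤ U_k(j)` and `q_{j+1} = k`,
  then `B̲(j+1) ≤ R_{j+1} ≤ B̄(j+1)`.
* **Lemma 10.13** For `j ≥ 0`, `U_a(j) = r B̄(j)` and `L_{−a}(j) = r B̲(j)`.
* **Lemma 10.14** Let `j, t ∈ ℕ`, `A_j ∈ ℚ`, `m_{−a}(j) = −∞`, and for `−a < k ≤ a` let `m_k(j)`
  satisfy `A_j < m_k(j) ⇒ r R_j < m_k(j)` (10.20) and `A_j ≥ m_k(j) ⇒ r R_j > m_k(j) − 2^(−t)`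
  (10.21).
  Let `q = q_{j+1}` be the greatest `k ∈ {−a, …, a}` with `m_k(j) ≤ A_j`, and assume
  `q ≠ a ⇒ m_{q+1}(j) ≤ U_q(j)` (10.22) and `q ≠ −a ⇒ L_q(j) + 2^(−t) ≤ m_q(j)` (10.23).
  If `B̲(j) ≤ R_j ≤ B̄(j)`, then `B̲(j+1) ≤ R_{j+1} ≤ B̄(j+1)`.
* The closing remark: (10.21) «is a consequence of (10.25)» `|A_j − r R_j| < 2^(−t)`, «and when»
  `2^t A_j` «and» `2^t m_k(j)` «are integers, so is (10.20)».

## Our reading (what the Lean statements say, and what they do not)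

* Everything is stated over `ℝ` (the book works with rationals); the radix is any natural `r`
  with exactly the hypothesis each proof uses (`0 < r` for 10.9/10.10/10.12/10.14, `2 ≤ r` for
  10.13; the book fixes `r = 2^k`). Negative powers `r^(−j)` are written `((r : ℝ) ^ j)⁻¹`.
* Digits are a function `q : ℕ → ℤ` (`q (i+1)` is the book's `q_{i+1}`); `ρ` is a real
  parameter in 10.10–10.12 and 10.14 (those proofs never use `ρ = a/(r−1)`), and is
  `SRT.rho a r` in 10.13, whose proof rests on `a + ρ = rρ` («As noted in the proof of Lemma 10.5»).
* Lemma 10.11 is stated under (10.5) `1/2 < ρ ≤ 1` and `1/4 ≤ x < 1`, as printed (its proof uses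
  only `1/2 ≤ ρ ≤ 3/2`).
* Lemma 10.14: «Assume that q is the greatest» `k ∈ {−a, …, a}` «such that» `m_k(j) ≤ A_j`,
  with `m_{−a}(j) = −∞`, is typed, as in our §10.1 file, by the two one-sided conditions its
  printed proof uses — `−a < q → m_q(j) ≤ A_j` and `q < a → A_j < m_{q+1}(j)` — together with
  `−a ≤ q ≤ a`; the comparison constants are a function `m : ℤ → ℝ` (values at `k ≤ −a` or
  `k > a` unused).
* IS NOT formalised: the convergence heuristic motivating (10.17) (the limit `√x = lim Q_j`),
  the covering inclusion display after Lemma 10.12 (only its ingredient Lemma 10.13 is), §10.5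
  (radix-4 square root, Fig. 10.4, Lemmas 10.15 ff.), §10.3, Chapters 18–21, and any RTL / Arm /
  ACL2 / engine claim.
-/

open Finset

namespace Literature.ComputerArithmetic.Russinoff2022

namespace SRTSqrt

open SRT (rho)

variable {x : ℝ} {r : ℕ} {q : ℕ → ℤ}

/-! ## §10.4 — partial roots (10.15), partial remainders (10.16), Lemma 10.9 -/

/-- Display (10.15): the partial root `Q_j = 1 + Σ_{i=1}^{j} r^(−i) q_i` (here the sum over
`i < j` of `r^(−(i+1)) q_{i+1}`). [cite: Russinoff2022, §10.4 display (10.15)] -/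
noncomputable def partialRoot (r : ℕ) (q : ℕ → ℤ) (j : ℕ) : ℝ :=
  1 + ∑ i ∈ Finset.range j, ((r : ℝ) ^ (i + 1))⁻¹ * q (i + 1)

/-- Display (10.16): the partial remainder `R_j = r^j (x − Q_j²)`.
[cite: Russinoff2022, §10.4 display (10.16)] -/
noncomputable def rootRemainder (r : ℕ) (x : ℝ) (q : ℕ → ℤ) (j : ℕ) : ℝ :=
  (r : ℝ) ^ j * (x - partialRoot r q j ^ 2)

/-- `Q_0 = 1` (empty sum). [cite: Russinoff2022, §10.4 display (10.15)] -/
theorem partialRoot_zero (r : ℕ) (q : ℕ → ℤ) : partialRoot r q 0 = 1 := by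
  simp [partialRoot]

/-- `Q_{j+1} = Q_j + r^(−(j+1)) q_{j+1}` (the step used in the proof of Lemma 10.9).
[cite: Russinoff2022, §10.4 proof of Lemma 10.9] -/
theorem partialRoot_succ (r : ℕ) (q : ℕ → ℤ) (j : ℕ) :
    partialRoot r q (j + 1) = partialRoot r q j + ((r : ℝ) ^ (j + 1))⁻¹ * q (j + 1) := by
  rw [partialRoot, Finset.sum_range_succ, partialRoot]; ring

/-- «Note that for all» `j ∈ ℕ`, `r^j Q_j ∈ ℤ` (for a radix `r > 0`).
[cite: Russinoff2022, §10.4 (remark after display (10.15))] -/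
theorem exists_int_pow_mul_partialRoot (hr : 0 < r) (q : ℕ → ℤ) (j : ℕ) :
    ∃ n : ℤ, (r : ℝ) ^ j * partialRoot r q j = n := by
  induction j with
  | zero => exact ⟨1, by simp [partialRoot_zero]⟩
  | succ j ih =>
    obtain ⟨n, hn⟩ := ih
    refine ⟨r * n + q (j + 1), ?_⟩
    have hr0 : (r : ℝ) ^ (j + 1) ≠ 0 := by positivity
    rw [partialRoot_succ, mul_add, ← mul_assoc, mul_inv_cancel₀ hr0, one_mul, pow_succ,
      mul_right_comm, hn]
    push_cast; ring

/-- Lemma 10.9, first part: `R_0 = x − 1`. [cite: Russinoff2022, Lemma 10.9 (§10.4)] -/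
theorem rootRemainder_zero (r : ℕ) (x : ℝ) (q : ℕ → ℤ) : rootRemainder r x q 0 = x - 1 := by
  simp [rootRemainder, partialRoot_zero]

/-- Lemma 10.9, second part: for `j ≥ 0` (radix `r > 0`),
`R_{j+1} = r R_j − q_{j+1} (2 Q_j + r^(−(j+1)) q_{j+1})`.
[cite: Russinoff2022, Lemma 10.9 (§10.4)] -/
theorem rootRemainder_succ (hr : 0 < r) (x : ℝ) (q : ℕ → ℤ) (j : ℕ) :
    rootRemainder r x q (j + 1) = r * rootRemainder r x q j
      - q (j + 1) * (2 * partialRoot r q j + ((r : ℝ) ^ (j + 1))⁻¹ * q (j + 1)) := by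
  have hc : (r : ℝ) ^ (j + 1) * ((r : ℝ) ^ (j + 1))⁻¹ = 1 := mul_inv_cancel₀ (by positivity)
  rw [rootRemainder, rootRemainder, partialRoot_succ]
  set Q := partialRoot r q j
  set c := ((r : ℝ) ^ (j + 1))⁻¹
  have : (r : ℝ) ^ (j + 1) * (x - (Q + c * q (j + 1)) ^ 2)
      = r * ((r : ℝ) ^ j * (x - Q ^ 2))
        - ((r : ℝ) ^ (j + 1) * c) * (q (j + 1) * (2 * Q + c * q (j + 1))) := by ring
  rw [this, hc, one_mul]

/-! ## §10.4 — the bounds `B̲(j)`, `B̄(j)` and the invariant (10.17); Lemmas 10.10, 10.11 -/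

/-- `B̲(j) = −2ρ Q_j + ρ² r^(−j)`. [cite: Russinoff2022, §10.4 (display before (10.17))] -/
noncomputable def lowerB (r : ℕ) (ρ : ℝ) (q : ℕ → ℤ) (j : ℕ) : ℝ :=
  -2 * ρ * partialRoot r q j + ρ ^ 2 * ((r : ℝ) ^ j)⁻¹

/-- `B̄(j) = 2ρ Q_j + ρ² r^(−j)`. [cite: Russinoff2022, §10.4 (display before (10.17))] -/
noncomputable def upperB (r : ℕ) (ρ : ℝ) (q : ℕ → ℤ) (j : ℕ) : ℝ :=
  2 * ρ * partialRoot r q j + ρ ^ 2 * ((r : ℝ) ^ j)⁻¹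

/-- Lemma 10.10 («(10.17) is equivalent to convergence»): for `j ≥ 0` and a radix `r > 0`,
`(Q_j − ρ r^(−j))² ≤ x ≤ (Q_j + ρ r^(−j))² ⇔ B̲(j) ≤ R_j ≤ B̄(j)`.
[cite: Russinoff2022, Lemma 10.10 (§10.4)] -/
theorem sq_le_and_le_sq_iff (hr : 0 < r) (ρ : ℝ) (j : ℕ) :
    (partialRoot r q j - ρ * ((r : ℝ) ^ j)⁻¹) ^ 2 ≤ x ∧
        x ≤ (partialRoot r q j + ρ * ((r : ℝ) ^ j)⁻¹) ^ 2 ↔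
      lowerB r ρ q j ≤ rootRemainder r x q j ∧ rootRemainder r x q j ≤ upperB r ρ q j := by
  have hp : (0 : ℝ) < (r : ℝ) ^ j := by positivity
  have hc : (r : ℝ) ^ j * ((r : ℝ) ^ j)⁻¹ = 1 := mul_inv_cancel₀ hp.ne'
  set Q := partialRoot r q j
  set c := ((r : ℝ) ^ j)⁻¹
  have h1 : (r : ℝ) ^ j * (Q - ρ * c) ^ 2 = (r : ℝ) ^ j * Q ^ 2 + lowerB r ρ q j := by
    simp only [lowerB]
    have : (r : ℝ) ^ j * (Q - ρ * c) ^ 2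
        = (r : ℝ) ^ j * Q ^ 2 - 2 * ρ * Q * ((r : ℝ) ^ j * c) + ρ ^ 2 * c * ((r : ℝ) ^ j * c) := by
      ring
    rw [this, hc]; ring
  have h2 : (r : ℝ) ^ j * (Q + ρ * c) ^ 2 = (r : ℝ) ^ j * Q ^ 2 + upperB r ρ q j := by
    simp only [upperB]
    have : (r : ℝ) ^ j * (Q + ρ * c) ^ 2
        = (r : ℝ) ^ j * Q ^ 2 + 2 * ρ * Q * ((r : ℝ) ^ j * c) + ρ ^ 2 * c * ((r : ℝ) ^ j * c) := by
      ring
    rw [this, hc]; ring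
  have hR : rootRemainder r x q j = (r : ℝ) ^ j * x - (r : ℝ) ^ j * Q ^ 2 := by
    rw [rootRemainder]; ring
  rw [← mul_le_mul_iff_right₀ hp (b := (Q - ρ * c) ^ 2), ← mul_le_mul_iff_right₀ hp (b := x),
    h1, h2, hR]
  constructor <;> rintro ⟨h3, h4⟩ <;> constructor <;> linarith

/-- Lemma 10.11: under `1/4 ≤ x < 1` and (10.5) `1/2 < ρ ≤ 1`, `B̲(0) ≤ R_0 ≤ B̄(0)` (indeed
`B̲(0) = (ρ−1)² − 1 ≤ −3/4 ≤ R_0 < 0 < 5/4 ≤ B̄(0)`). [cite: Russinoff2022, Lemma 10.11 (§10.4)] -/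
theorem lowerB_zero_le_and_le_upperB_zero (hx1 : 1 / 4 ≤ x) (hx2 : x < 1) {ρ : ℝ}
    (hρ1 : 1 / 2 < ρ) (hρ2 : ρ ≤ 1) (r : ℕ) (q : ℕ → ℤ) :
    lowerB r ρ q 0 ≤ rootRemainder r x q 0 ∧ rootRemainder r x q 0 ≤ upperB r ρ q 0 := by
  rw [rootRemainder_zero]; simp only [lowerB, upperB, partialRoot_zero, pow_zero, inv_one, mul_one]
  constructor <;> nlinarith

/-! ## §10.4 — selection intervals (10.18), (10.19); Lemmas 10.12, 10.13 -/

/-- Display (10.18): `U_k(j) = 2(k+ρ) Q_j + (k+ρ)² r^(−(j+1))`.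
[cite: Russinoff2022, §10.4 display (10.18)] -/
noncomputable def selU (r : ℕ) (ρ : ℝ) (q : ℕ → ℤ) (j : ℕ) (k : ℤ) : ℝ :=
  2 * (k + ρ) * partialRoot r q j + (k + ρ) ^ 2 * ((r : ℝ) ^ (j + 1))⁻¹

/-- Display (10.19): `L_k(j) = 2(k−ρ) Q_j + (k−ρ)² r^(−(j+1))`.
[cite: Russinoff2022, §10.4 display (10.19)] -/
noncomputable def selL (r : ℕ) (ρ : ℝ) (q : ℕ → ℤ) (j : ℕ) (k : ℤ) : ℝ :=
  2 * (k - ρ) * partialRoot r q j + (k - ρ) ^ 2 * ((r : ℝ) ^ (j + 1))⁻¹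

/-- Lemma 10.12 (the selection interval «is so named because if the shifted partial remainder»
`r R_j` «lies in this interval, then the invariant (10.17) may be ensured by choosing»
`q_{j+1} = k`): for a radix `r > 0`, if `L_k(j) ≤ r R_j ≤ U_k(j)` and `q_{j+1} = k` then
`B̲(j+1) ≤ R_{j+1} ≤ B̄(j+1)` (the digit bound `−a ≤ k ≤ a` of the printed statement is not
used). [cite: Russinoff2022, Lemma 10.12 (§10.4)] -/
theorem bounds_succ_of_mem_sel (hr : 0 < r) (ρ : ℝ) {j : ℕ} {k : ℤ}
    (hL : selL r ρ q j k ≤ r * rootRemainder r x q j)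
    (hU : r * rootRemainder r x q j ≤ selU r ρ q j k) (hq : q (j + 1) = k) :
    lowerB r ρ q (j + 1) ≤ rootRemainder r x q (j + 1) ∧
      rootRemainder r x q (j + 1) ≤ upperB r ρ q (j + 1) := by
  have hR := rootRemainder_succ hr x q j
  have hQ := partialRoot_succ r q j
  rw [hq] at hR hQ
  set Q := partialRoot r q j
  set c := ((r : ℝ) ^ (j + 1))⁻¹
  simp only [selL, selU] at hL hU
  simp only [lowerB, upperB, hQ, hR]
  constructor <;> nlinarith [hL, hU]

/-- «As noted in the proof of Lemma 10.5,» `a + ρ = rρ` for `ρ = a/(r−1)` and `r ≥ 2`.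
[cite: Russinoff2022, §10.4 proof of Lemma 10.13] -/
theorem nat_add_rho_eq {a : ℕ} (hr : 2 ≤ r) : (a : ℝ) + rho a r = r * rho a r := by
  have hr1 : (r : ℝ) - 1 ≠ 0 := by
    have : (2 : ℝ) ≤ r := by exact_mod_cast hr
    linarith
  simp only [rho]; field_simp; ring

/-- Lemma 10.13: for `j ≥ 0`, `ρ = a/(r−1)`, `r ≥ 2`: `U_a(j) = r B̄(j)` and `L_{−a}(j) = r B̲(j)`.
[cite: Russinoff2022, Lemma 10.13 (§10.4)] -/
theorem selU_a_eq_and_selL_neg_a_eq {a : ℕ} (hr : 2 ≤ r) (q : ℕ → ℤ) (j : ℕ) :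
    selU r (rho a r) q j a = r * upperB r (rho a r) q j ∧
      selL r (rho a r) q j (-(a : ℤ)) = r * lowerB r (rho a r) q j := by
  have hr0 : (r : ℝ) ≠ 0 := by
    have : (2 : ℝ) ≤ r := by exact_mod_cast hr
    positivity
  have ha := nat_add_rho_eq (a := a) hr
  have hc : ((r : ℝ) ^ (j + 1))⁻¹ = ((r : ℝ) ^ j)⁻¹ * (r : ℝ)⁻¹ := by
    rw [pow_succ, mul_inv]
  simp only [selU, selL, upperB, lowerB, hc]; push_cast
  have h1 : (a : ℝ) + rho a r = r * rho a r := ha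
  have h2 : -(a : ℝ) - rho a r = -(r * rho a r) := by linarith
  rw [h1, h2]
  constructor <;> field_simp

/-! ## §10.4 — digit selection by comparison constants: Lemma 10.14 and the closing remark -/

/-- Lemma 10.14 (the analog of Lemma 10.6 for the square root): radix `r > 0`, digit bound `a`,
`t ∈ ℕ`, an approximation `A` of `r R_j`, comparison constants `m_k(j)` (a function `m : ℤ → ℝ`;
`m_{−a} = −∞` is encoded by never consulting `m` at `−a`) with (10.20) `A < m_k → r R_j < m_k`
and (10.21) `m_k ≤ A → m_k − 2^(−t) < r R_j` for `−a < k ≤ a`; `q = q_{j+1}` with `−a ≤ q ≤ a`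
the greatest digit with `m_q ≤ A` (read: `−a < q → m_q ≤ A` and `q < a → A < m_{q+1}`), (10.22)
`q ≠ a → m_{q+1} ≤ U_q(j)`, (10.23) `q ≠ −a → L_q(j) + 2^(−t) ≤ m_q`. If `B̲(j) ≤ R_j ≤ B̄(j)`
then `B̲(j+1) ≤ R_{j+1} ≤ B̄(j+1)`. Here `ρ = a/(r−1)` with `r ≥ 2` (Lemma 10.13 is invoked).
[cite: Russinoff2022, Lemma 10.14 (§10.4)] -/
theorem bounds_succ_of_compare {a : ℕ} (hr : 2 ≤ r) {j t : ℕ} {A : ℝ} {m : ℤ → ℝ}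
    (h20 : ∀ k : ℤ, -(a : ℤ) < k → k ≤ a → A < m k → r * rootRemainder r x q j < m k)
    (h21 : ∀ k : ℤ, -(a : ℤ) < k → k ≤ a → m k ≤ A →
      m k - (2 : ℝ) ^ (-(t : ℤ)) < r * rootRemainder r x q j)
    (hq1 : -(a : ℤ) ≤ q (j + 1)) (hq2 : q (j + 1) ≤ a)
    (hge : -(a : ℤ) < q (j + 1) → m (q (j + 1)) ≤ A)
    (hgt : q (j + 1) < a → A < m (q (j + 1) + 1))
    (h22 : q (j + 1) ≠ a → m (q (j + 1) + 1) ≤ selU r (rho a r) q j (q (j + 1)))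
    (h23 : q (j + 1) ≠ -(a : ℤ) →
      selL r (rho a r) q j (q (j + 1)) + (2 : ℝ) ^ (-(t : ℤ)) ≤ m (q (j + 1)))
    (hB : lowerB r (rho a r) q j ≤ rootRemainder r x q j ∧
      rootRemainder r x q j ≤ upperB r (rho a r) q j) :
    lowerB r (rho a r) q (j + 1) ≤ rootRemainder r x q (j + 1) ∧
      rootRemainder r x q (j + 1) ≤ upperB r (rho a r) q (j + 1) := by
  have hr0 : 0 < r := by omega
  have hrpos : (0 : ℝ) < r := by exact_mod_cast hr0
  set kq := q (j + 1) with hkq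
  obtain ⟨h13U, h13L⟩ := selU_a_eq_and_selL_neg_a_eq (a := a) hr q j
  -- `L_q(j) ≤ r R_j`
  have hL : selL r (rho a r) q j kq ≤ r * rootRemainder r x q j := by
    rcases eq_or_lt_of_le hq1 with h | h
    · -- q = −a: Lemma 10.13
      rw [← h, h13L]
      exact (mul_le_mul_iff_right₀ hrpos).2 hB.1
    · have hm : m kq ≤ A := hge h
      have h1 := h21 kq h hq2 hm
      have h2 := h23 (ne_of_gt h)
      linarith
  -- `r R_j ≤ U_q(j)`
  have hU : r * rootRemainder r x q j ≤ selU r (rho a r) q j kq := by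
    rcases eq_or_lt_of_le hq2 with h | h
    · rw [h, h13U]
      exact (mul_le_mul_iff_right₀ hrpos).2 hB.2
    · have hA : A < m (kq + 1) := hgt h
      have h1 := h20 (kq + 1) (by omega) (by omega) hA
      have h2 := h22 (ne_of_lt h)
      linarith
  exact bounds_succ_of_mem_sel hr0 (rho a r) hL hU rfl

/-- The closing remark of §10.4, first half: (10.21) «is a consequence of (10.25)»
`|A_j − r R_j| < 2^(−t)`.
[cite: Russinoff2022, §10.4 (remark after Lemma 10.14, display (10.25))] -/
theorem h21_of_abs_sub_lt {t : ℕ} {A y mk : ℝ} (h25 : |A - y| < (2 : ℝ) ^ (-(t : ℤ)))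
    (hm : mk ≤ A) : mk - (2 : ℝ) ^ (-(t : ℤ)) < y := by
  have := (abs_sub_lt_iff.1 h25).1
  linarith

/-- The closing remark of §10.4, second half: «when» `2^t A_j` «and» `2^t m_k(j)` «are integers,
so is (10.20)» a consequence of (10.25): if `A < m_k` with both on the grid `2^(−t)ℤ` then
`A ≤ m_k − 2^(−t)`, hence `r R_j < A + 2^(−t) ≤ m_k`.
[cite: Russinoff2022, §10.4 (remark after Lemma 10.14, display (10.25))] -/
theorem h20_of_abs_sub_lt {t : ℕ} {A y mk : ℝ} (hA : ∃ z : ℤ, A = z * (2 : ℝ) ^ (-(t : ℤ)))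
    (hmk : ∃ z : ℤ, mk = z * (2 : ℝ) ^ (-(t : ℤ))) (h25 : |A - y| < (2 : ℝ) ^ (-(t : ℤ)))
    (hlt : A < mk) : y < mk := by
  obtain ⟨nA, hA⟩ := hA
  obtain ⟨nm, hmk⟩ := hmk
  have hε : (0 : ℝ) < (2 : ℝ) ^ (-(t : ℤ)) := by positivity
  have h1 : (nA : ℝ) < nm := by
    rw [hA, hmk] at hlt
    exact (mul_lt_mul_iff_left₀ hε).1 hlt
  have h2 : nA + 1 ≤ nm := by exact_mod_cast h1
  have h3 : A + (2 : ℝ) ^ (-(t : ℤ)) ≤ mk := by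
    rw [hA, hmk]
    have : ((nA : ℝ) + 1) * (2 : ℝ) ^ (-(t : ℤ)) ≤ nm * (2 : ℝ) ^ (-(t : ℤ)) :=
      (mul_le_mul_iff_left₀ hε).2 (by exact_mod_cast h2)
    linarith
  have := (abs_sub_lt_iff.1 h25).2
  linarith

end SRTSqrt

end Literature.ComputerArithmetic.Russinoff2022
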